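import Mathlib
import Literature.AlgebraicGeometry.Tropical.InitialIdeal
import Literature.AlgebraicGeometry.Tropical.TropicalLink
import Literature.AlgebraicGeometry.Resolution.WeightedMonomialQuasiRegular

/-!
# TropicalLinks / InductiveStep — the special fibre of the ray algebra of an snc stratum
# (brick C1 for `stub_sncClosureSchon`)

Route `ResolutionOfSingularities/TropicalLinks`, crux `InductiveStep`
(stmt-ResolutionOfSingularities-17233), line `split`, in support of stub `stub_sncClosureSchon`
(Luxton–Qu, Prop. 3.1: an snc compactification makes the principal open schön). By the landed
dictionary `tropicalLinks_isSchonIdeal_iff_forall_rayFibre`, schön ⟺ regular with regular ray fibres;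
for a ray in the relative interior of the cone of an snc stratum with local equations `m₁, …, m_l` of
the boundary divisors and integer weights `bᵢ ≥ 1`, the closure of the open in the toric partial
compactification along the ray is `Spec A[m^a : a ∈ ℤ^l, ⟨b, a⟩ ≥ 0] ⊆ Spec A[1/(m₁⋯m_l)]`, with fibre
ideal `(m^a : ⟨b, a⟩ > 0)`.

**Informal statement** (`tropicalLinks_nonempty_rayAlgebra_quotient_algEquiv`, registered brick C1).
Let `m₁, …, m_l ∈ A` be a permutable regular family (each `mᵢ` a non-zero-divisor modulo the others,
for every sub-family) and `b ∈ ℤ^l_{>0}`. Then the special fibre of the ray algebra,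
`A[m^a : ⟨b, a⟩ ≥ 0] ⧸ (m^a : ⟨b, a⟩ > 0)`, is `A`-isomorphic to the Laurent ring
`(A ⧸ (m₁, …, m_l))[K_b]` on the kernel lattice `K_b = {a : ⟨b, a⟩ = 0} ≅ ℤ^{l-1}` — geometrically the
fibre is `𝔾_m^{l-1} × (stratum)`, hence regular when the stratum is.

**Proof sketch.** The ray algebra is spanned over `A` by the monomials of weight `≥ 0`, the fibre
ideal by those of weight `> 0`. The map `(A ⧸ (m))[K_b] → (ray algebra) ⧸ (fibre ideal)`,
`[r] x^a ↦ r m^a`, is a well-defined (`mᵢ = m^{eᵢ}` has weight `bᵢ > 0`) surjective `A`-algebra map.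
Injectivity is **weighted quasi-regularity** (`coeff_mem_span_of_isWeightedHomogeneous`, the weighted
form of Rees' theorem, Matsumura Thm. 16.2, = Włodarczyk's weighted normal bundle): if
`∑ r_a m^a` (`⟨b, a⟩ = 0`) is an `A`-combination of monomials of positive weight, clear denominators by
`m^d`; then the `b`-homogeneous polynomial `∑ r_a X^{a+d}` of weight `δ = ⟨b, d⟩` evaluates into the
weighted monomial ideal of weight `δ + 1`, so all `r_a ∈ (m₁, …, m_l)`. No new definitions.
-/

set_option linter.dupNamespace false -- single-conjunct summit: doubled namespace component is mandated

namespace Summit.ResolutionOfSingularities.ResolutionOfSingularities.Theorems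

open Literature.AlgebraicGeometry.Resolution

/-- `v^(a + c) = v^a · v^c` for integer exponent vectors. [folklore] -/
theorem tropicalLinks_rayAlgebra_prod_zpow_add {G : Type*} [CommGroup G] {l : ℕ} (v : Fin l → G)
    (a c : Fin l → ℤ) : ∏ i, v i ^ (a i + c i) = (∏ i, v i ^ a i) * ∏ i, v i ^ c i := by
  rw [← Finset.prod_mul_distrib]
  exact Finset.prod_congr rfl fun i _ => zpow_add _ _ _

/-- `v^{eᵢ} = vᵢ` for the `i`-th basis vector `eᵢ`. [folklore] -/
theorem tropicalLinks_rayAlgebra_prod_zpow_single {G : Type*} [CommGroup G] {l : ℕ} (v : Fin l → G)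
    (i : Fin l) : ∏ j, v j ^ (Pi.single i (1 : ℤ) : Fin l → ℤ) j = v i := by
  rw [Finset.prod_eq_single i (fun j _ hj => by rw [Pi.single_eq_of_ne hj, zpow_zero])
    (fun h => absurd (Finset.mem_univ i) h), Pi.single_eq_same, zpow_one]

/-- For natural exponents, `v^e` is the image of `∏ mᵢ ^ eᵢ ∈ A`. [folklore] -/
theorem tropicalLinks_rayAlgebra_prod_zpow_natCast {A L : Type*} [CommRing A] [CommRing L]
    [Algebra A L] {l : ℕ} (m : Fin l → A) (v : Fin l → Lˣ)
    (hv : ∀ i, (v i : L) = algebraMap A L (m i)) (e : Fin l → ℕ) :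
    ((∏ i, v i ^ (e i : ℤ) : Lˣ) : L) = algebraMap A L (∏ i, m i ^ e i) := by
  rw [Units.coe_prod, map_prod]
  exact Finset.prod_congr rfl fun i _ => by
    rw [zpow_natCast, Units.val_pow_eq_pow_val, hv, map_pow]

/-- Clearing denominators: `v^a · ∏ mᵢ ^ dᵢ = ∏ mᵢ ^ (aᵢ + dᵢ)` when `a + d ≥ 0`. [folklore] -/
theorem tropicalLinks_rayAlgebra_prod_zpow_mul_algebraMap {A L : Type*} [CommRing A] [CommRing L]
    [Algebra A L] {l : ℕ} (m : Fin l → A) (v : Fin l → Lˣ)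
    (hv : ∀ i, (v i : L) = algebraMap A L (m i)) (a : Fin l → ℤ) (d : Fin l → ℕ)
    (h : ∀ i, 0 ≤ a i + d i) :
    ((∏ i, v i ^ a i : Lˣ) : L) * algebraMap A L (∏ i, m i ^ d i) =
      algebraMap A L (∏ i, m i ^ (a i + d i).toNat) := by
  rw [← tropicalLinks_rayAlgebra_prod_zpow_natCast m v hv d, ← Units.val_mul,
    ← tropicalLinks_rayAlgebra_prod_zpow_add, ← tropicalLinks_rayAlgebra_prod_zpow_natCast m v hv]
  refine congrArg Units.val (Finset.prod_congr rfl fun i _ => ?_)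
  rw [Int.toNat_of_nonneg (h i)]

/-- **Weighted quasi-regularity for finite sums of monomials.** If `∑_{j ∈ F} r_j m^{e_j}` with
distinct exponents `e_j` of `b`-weight `δ` equals a combination of monomials of weight `≥ δ + 1`,
then all `r_j ∈ (m₁, …, m_l)` (from `coeff_mem_span_of_isWeightedHomogeneous`). [folklore] -/
theorem tropicalLinks_rayAlgebra_mem_span_of_sum_eq {A : Type*} [CommRing A] {l : ℕ}
    (m : Fin l → A) (b : Fin l → ℕ) (hb : ∀ i, 0 < b i)
    (hperm : ∀ (i : Fin l) (T : Set (Fin l)), i ∉ T → ∀ y : A,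
      m i * y ∈ Ideal.span (m '' T) → y ∈ Ideal.span (m '' T))
    {ι κ : Type*} (F : Finset ι) (e : ι → Fin l → ℕ) (he : Set.InjOn e ↑F) (r : ι → A) (δ : ℕ)
    (hδ : ∀ j ∈ F, ∑ k, b k * e j k = δ) (G : Finset κ) (e' : κ → Fin l → ℕ) (s : κ → A)
    (hδ' : ∀ i ∈ G, δ + 1 ≤ ∑ k, b k * e' i k)
    (heq : ∑ j ∈ F, r j * ∏ k, m k ^ e j k = ∑ i ∈ G, s i * ∏ k, m k ^ e' i k) :
    ∀ j ∈ F, r j ∈ Ideal.span (Set.range m) := by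
  classical
  have hprod : ∀ g : Fin l → ℕ,
      (Finsupp.equivFunOnFinite.symm g).prod (fun i k => m i ^ k) = ∏ i, m i ^ g i := fun g => by
    rw [Finsupp.prod_fintype _ _ (fun i => pow_zero _)]
    rfl
  have hwt : ∀ g : Fin l → ℕ,
      Finsupp.weight b (Finsupp.equivFunOnFinite.symm g) = ∑ i, b i * g i := fun g => by
    rw [Finsupp.weight_apply, Finsupp.sum_fintype]
    · exact Finset.sum_congr rfl fun i _ => by rw [smul_eq_mul, mul_comm]; rfl
    · exact fun i => zero_smul _ _
  set P : MvPolynomial (Fin l) A :=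
    ∑ j ∈ F, MvPolynomial.monomial (Finsupp.equivFunOnFinite.symm (e j)) (r j) with hP
  have hPhom : P.IsWeightedHomogeneous b δ := by
    refine MvPolynomial.IsWeightedHomogeneous.sum F _ δ fun j hj => ?_
    exact MvPolynomial.isWeightedHomogeneous_monomial _ _ _ (by rw [hwt, hδ j hj])
  have hcoeff : ∀ j ∈ F, P.coeff (Finsupp.equivFunOnFinite.symm (e j)) = r j := by
    intro j hj
    rw [hP, MvPolynomial.coeff_sum, Finset.sum_eq_single j]
    · rw [MvPolynomial.coeff_monomial, if_pos rfl]
    · exact fun j' hj' hne => by rw [MvPolynomial.coeff_monomial,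
        if_neg fun h => hne (he hj' hj (Finsupp.equivFunOnFinite.symm.injective h))]
    · exact fun h => absurd hj h
  have heval : MvPolynomial.eval m P = ∑ i ∈ G, s i * ∏ k, m k ^ e' i k := by
    rw [← heq, hP, map_sum]
    exact Finset.sum_congr rfl fun j _ => by rw [MvPolynomial.eval_monomial, hprod]
  have hmem : MvPolynomial.eval m P ∈ Ideal.span {x : A | ∃ β : Fin l →₀ ℕ,
      (↑β.support : Set (Fin l)) ⊆ ↑(Finset.univ : Finset (Fin l)) ∧
        δ + 1 ≤ Finsupp.weight b β ∧ β.prod (fun i e => m i ^ e) = x} := by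
    rw [heval]
    refine Ideal.sum_mem _ fun i hi => Ideal.mul_mem_left _ _ ?_
    rw [← hprod]
    exact prod_mem_weightedSpan m b (by simp) (by rw [hwt]; exact hδ' i hi)
  intro j hj
  have key := coeff_mem_span_of_isWeightedHomogeneous m b Finset.univ (fun i _ => hb i)
    (fun i _ T _ hiT y hy => hperm i T hiT y hy) hPhom (fun β _ => by simp) hmem
    (Finsupp.equivFunOnFinite.symm (e j))
  rw [hcoeff j hj, Finset.coe_univ, Set.image_univ] at key
  exact key

/-- **The injectivity core over `A[1/∏ mᵢ]`.** If an `A`-combination `∑_{j ∈ F} r_j v^{a_j}` of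
monomials of `b`-weight `0` (distinct exponents) is an `A`-combination of monomials of weight `≥ 1`,
then all `r_j ∈ (m₁, …, m_l)`: clear denominators and apply weighted quasi-regularity. [folklore] -/
theorem tropicalLinks_rayAlgebra_mem_span_of_sum_smul_mem {A L : Type*} [CommRing A] [CommRing L]
    [Algebra A L] {l : ℕ} (m : Fin l → A) (b : Fin l → ℕ) (hb : ∀ i, 0 < b i)
    (hperm : ∀ (i : Fin l) (T : Set (Fin l)), i ∉ T → ∀ y : A,
      m i * y ∈ Ideal.span (m '' T) → y ∈ Ideal.span (m '' T))
    (hinj : Function.Injective (algebraMap A L)) (v : Fin l → Lˣ)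
    (hv : ∀ i, (v i : L) = algebraMap A L (m i)) {ι : Type*} (F : Finset ι) (a : ι → Fin l → ℤ)
    (ha : Set.InjOn a ↑F) (hK : ∀ j ∈ F, ∑ i, (b i : ℤ) * a j i = 0) (r : ι → A)
    (hmem : ∑ j ∈ F, r j • ((∏ i, v i ^ a j i : Lˣ) : L) ∈ Submodule.span A
      {x : L | ∃ c : Fin l → ℤ, 1 ≤ ∑ i, (b i : ℤ) * c i ∧ x = ((∏ i, v i ^ c i : Lˣ) : L)}) :
    ∀ j ∈ F, r j ∈ Ideal.span (Set.range m) := by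
  classical
  obtain ⟨n, f, g, hfg⟩ := Submodule.mem_span_set'.mp hmem
  have hg : ∀ i, ∃ c : Fin l → ℤ, 1 ≤ ∑ k, (b k : ℤ) * c k ∧
      (g i : L) = ((∏ k, v k ^ c k : Lˣ) : L) := fun i => (g i).2
  choose c hc1 hc2 using hg
  -- a common denominator `∏ mₖ ^ dₖ`
  set d : Fin l → ℕ := fun k => ∑ j ∈ F, (a j k).natAbs + ∑ i, (c i k).natAbs with hd
  have hda : ∀ j ∈ F, ∀ k, 0 ≤ a j k + d k := fun j hj k => by
    have h1 : (a j k).natAbs ≤ ∑ j ∈ F, (a j k).natAbs :=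
      Finset.single_le_sum (f := fun j => (a j k).natAbs) (fun _ _ => Nat.zero_le _) hj
    simp only [hd]; omega
  have hdc : ∀ i k, 0 ≤ c i k + d k := fun i k => by
    have h1 : (c i k).natAbs ≤ ∑ i, (c i k).natAbs := Finset.single_le_sum
      (f := fun i => (c i k).natAbs) (fun _ _ => Nat.zero_le _) (Finset.mem_univ i)
    simp only [hd]; omega
  have hL := congrArg (fun x => x * algebraMap A L (∏ k, m k ^ d k)) hfg
  simp only [Finset.sum_mul] at hL
  have e1 : ∀ j ∈ F, r j • ((∏ i, v i ^ a j i : Lˣ) : L) * algebraMap A L (∏ k, m k ^ d k) =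
      algebraMap A L (r j * ∏ k, m k ^ (a j k + d k).toNat) := by
    intro j hj
    rw [smul_mul_assoc, tropicalLinks_rayAlgebra_prod_zpow_mul_algebraMap m v hv (a j) d (hda j hj),
      Algebra.smul_def, map_mul]
  have e2 : ∀ i ∈ (Finset.univ : Finset (Fin n)),
      f i • (g i : L) * algebraMap A L (∏ k, m k ^ d k) =
        algebraMap A L (f i * ∏ k, m k ^ (c i k + d k).toNat) := by
    intro i _
    rw [hc2 i, smul_mul_assoc, tropicalLinks_rayAlgebra_prod_zpow_mul_algebraMap m v hv (c i) d
      (hdc i), Algebra.smul_def, map_mul]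
  rw [Finset.sum_congr rfl e1, Finset.sum_congr rfl e2, ← map_sum, ← map_sum] at hL
  have hA := hinj hL
  refine tropicalLinks_rayAlgebra_mem_span_of_sum_eq m b hb hperm F (fun j k => (a j k + d k).toNat)
    ?_ r (∑ k, b k * d k) ?_ Finset.univ (fun i k => (c i k + d k).toNat) f ?_ hA.symm
  · intro j hj j' hj' h
    refine ha hj hj' (funext fun k => ?_)
    have h1 := hda j hj k; have h2 := hda j' hj' k; have h3 := congr_fun h k
    simp only at h3; omega
  · intro j hj
    have h0 := hK j hj
    have key : ((∑ k, b k * (a j k + d k).toNat : ℕ) : ℤ) = ((∑ k, b k * d k : ℕ) : ℤ) := by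
      simp only [Nat.cast_sum, Nat.cast_mul]
      rw [← sub_eq_zero, ← Finset.sum_sub_distrib, ← h0]
      exact Finset.sum_congr rfl fun k _ => by rw [Int.toNat_of_nonneg (hda j hj k)]; ring
    exact_mod_cast key
  · intro i _
    have h0 := hc1 i
    have key : ((∑ k, b k * d k : ℕ) : ℤ) + 1 ≤ ((∑ k, b k * (c i k + d k).toNat : ℕ) : ℤ) := by
      simp only [Nat.cast_sum, Nat.cast_mul]
      have e : ∑ k, (b k : ℤ) * (((c i k + d k).toNat : ℕ) : ℤ) =
          ∑ k, (b k : ℤ) * c i k + ∑ k, (b k : ℤ) * (d k : ℤ) := by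
        rw [← Finset.sum_add_distrib]
        exact Finset.sum_congr rfl fun k _ => by rw [Int.toNat_of_nonneg (hdc i k)]; ring
      rw [e]; linarith
    exact_mod_cast key

/-- Products of monomial spans: weights add. [folklore] -/
theorem tropicalLinks_rayAlgebra_span_mul_span_le {A L : Type*} [CommRing A] [CommRing L]
    [Algebra A L] {l : ℕ} (b : Fin l → ℕ) (v : Fin l → Lˣ) (n n' : ℤ) :
    Submodule.span A {x : L | ∃ c : Fin l → ℤ, n ≤ ∑ i, (b i : ℤ) * c i ∧
        x = ((∏ i, v i ^ c i : Lˣ) : L)} *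
      Submodule.span A {x : L | ∃ c : Fin l → ℤ, n' ≤ ∑ i, (b i : ℤ) * c i ∧
        x = ((∏ i, v i ^ c i : Lˣ) : L)} ≤
      Submodule.span A {x : L | ∃ c : Fin l → ℤ, n + n' ≤ ∑ i, (b i : ℤ) * c i ∧
        x = ((∏ i, v i ^ c i : Lˣ) : L)} := by
  rw [Submodule.span_mul_span]
  refine Submodule.span_mono ?_
  rintro _ ⟨x, ⟨c, hc, rfl⟩, y, ⟨c', hc', rfl⟩, rfl⟩
  refine ⟨c + c', ?_, ?_⟩
  · have e : ∑ i, (b i : ℤ) * (c + c') i = ∑ i, (b i : ℤ) * c i + ∑ i, (b i : ℤ) * c' i := by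
      rw [← Finset.sum_add_distrib]
      exact Finset.sum_congr rfl fun i _ => by rw [Pi.add_apply, mul_add]
    exact e ▸ add_le_add hc hc'
  · beta_reduce
    rw [← Units.val_mul, ← tropicalLinks_rayAlgebra_prod_zpow_add]
    rfl

/-- The ray algebra `A[v^a : ⟨b, a⟩ ≥ 0]` is spanned over `A` by its monomials. [folklore] -/
theorem tropicalLinks_rayAlgebra_adjoin_le_span {A L : Type*} [CommRing A] [CommRing L]
    [Algebra A L] {l : ℕ} (b : Fin l → ℕ) (v : Fin l → Lˣ) (x : L)
    (hx : x ∈ Algebra.adjoin A {x : L | ∃ c : Fin l → ℤ, 0 ≤ ∑ i, (b i : ℤ) * c i ∧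
      x = ((∏ i, v i ^ c i : Lˣ) : L)}) :
    x ∈ Submodule.span A {x : L | ∃ c : Fin l → ℤ, 0 ≤ ∑ i, (b i : ℤ) * c i ∧
      x = ((∏ i, v i ^ c i : Lˣ) : L)} := by
  induction hx using Algebra.adjoin_induction with
  | mem x hx => exact Submodule.subset_span hx
  | algebraMap r =>
    rw [Algebra.algebraMap_eq_smul_one]
    exact Submodule.smul_mem _ _ (Submodule.subset_span ⟨0, by simp, by simp⟩)
  | add x y _ _ hx hy => exact Submodule.add_mem _ hx hy
  | mul x y _ _ hx hy =>
    have h := tropicalLinks_rayAlgebra_span_mul_span_le b v 0 0 (Submodule.mul_mem_mul hx hy)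
    rwa [add_zero] at h

/-- Elements of the fibre ideal `(v^a : ⟨b, a⟩ > 0)` of the ray algebra are `A`-combinations of
monomials of positive weight. [folklore] -/
theorem tropicalLinks_rayAlgebra_coe_mem_span_of_mem_span {A L : Type*} [CommRing A] [CommRing L]
    [Algebra A L] {l : ℕ} (b : Fin l → ℕ) (v : Fin l → Lˣ) (S : Subalgebra A L)
    (hS : S = Algebra.adjoin A {x : L | ∃ c : Fin l → ℤ, 0 ≤ ∑ i, (b i : ℤ) * c i ∧
      x = ((∏ i, v i ^ c i : Lˣ) : L)}) (y : ↥S)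
    (hy : y ∈ Ideal.span {x : ↥S | ∃ c : Fin l → ℤ, 0 < ∑ i, (b i : ℤ) * c i ∧
      (x : L) = ((∏ i, v i ^ c i : Lˣ) : L)}) :
    (y : L) ∈ Submodule.span A {x : L | ∃ c : Fin l → ℤ, 1 ≤ ∑ i, (b i : ℤ) * c i ∧
      x = ((∏ i, v i ^ c i : Lˣ) : L)} := by
  induction hy using Submodule.span_induction with
  | mem x hx =>
    obtain ⟨c, hc, hx⟩ := hx
    exact Submodule.subset_span ⟨c, by omega, hx⟩
  | zero => exact Submodule.zero_mem _
  | add x y _ _ hx hy =>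
    rw [Subalgebra.coe_add]
    exact Submodule.add_mem _ hx hy
  | smul a x _ hx =>
    rw [smul_eq_mul, Subalgebra.coe_mul]
    have ha : (a : L) ∈ Algebra.adjoin A {x : L | ∃ c : Fin l → ℤ, 0 ≤ ∑ i, (b i : ℤ) * c i ∧
        x = ((∏ i, v i ^ c i : Lˣ) : L)} := by
      rw [← hS]; exact a.2
    have h := tropicalLinks_rayAlgebra_span_mul_span_le b v 0 1
      (Submodule.mul_mem_mul (tropicalLinks_rayAlgebra_adjoin_le_span b v a ha) hx)
    rwa [zero_add] at h

set_option maxHeartbeats 400000 in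
/-- **Brick C1: the special fibre of the toric partial compactification along a weighted ray through
an snc stratum is the Laurent ring over the stratum.** For a permutable regular family `m₁, …, m_l`
in `A`, positive weights `b`, the units `vᵢ = mᵢ` of `A[1/∏ mᵢ]`, the ray algebra
`S = A[v^a : ⟨b, a⟩ ≥ 0]` and its fibre ideal `J = (v^a : ⟨b, a⟩ > 0)`, there is an `A`-algebra
isomorphism `S ⧸ J ≃ (A ⧸ (m₁, …, m_l))[ker ⟨b, ·⟩]`. The key input is weighted quasi-regularity
(Rees; Matsumura Thm. 16.2, weighted; Włodarczyk's weighted normal bundle). [folklore] -/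
theorem tropicalLinks_nonempty_rayAlgebra_quotient_algEquiv :
    ∀ (A : Type) [CommRing A] (l : ℕ) (m : Fin l → A) (b : Fin l → ℕ), (∀ i, 0 < b i) → (∀ (i : Fin l) (T : Set (Fin l)), i ∉ T → ∀ y : A, m i * y ∈ Ideal.span (m '' T) → y ∈ Ideal.span (m '' T)) → ∀ (v : Fin l → (Localization.Away (∏ i, m i))ˣ), (∀ i, (v i : Localization.Away (∏ i, m i)) = algebraMap A (Localization.Away (∏ i, m i)) (m i)) → ∀ (S : Subalgebra A (Localization.Away (∏ i, m i))), S = Algebra.adjoin A {x : Localization.Away (∏ i, m i) | ∃ a : Fin l → ℤ, 0 ≤ ∑ i, (b i : ℤ) * a i ∧ x = ((∏ i, v i ^ a i : (Localization.Away (∏ i, m i))ˣ) : Localization.Away (∏ i, m i))} → ∀ (J : Ideal ↥S), J = Ideal.span {x : ↥S | ∃ a : Fin l → ℤ, 0 < ∑ i, (b i : ℤ) * a i ∧ (x : Localization.Away (∏ i, m i)) = ((∏ i, v i ^ a i : (Localization.Away (∏ i, m i))ˣ) : Localization.Away (∏ i, m i))} → Nonempty ((↥S ⧸ J) ≃ₐ[A]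 AddMonoidAlgebra (A ⧸ Ideal.span (Set.range m)) ↥(AddMonoidHom.ker (Literature.AlgebraicGeometry.Tropical.dotWeightHom (fun i => (b i : ℤ))))) := by
  intro A _ l m b hb hperm v hv S hS J hJ
  classical
  set K := AddMonoidHom.ker (Literature.AlgebraicGeometry.Tropical.dotWeightHom fun i => (b i : ℤ))
  have hKmem : ∀ c : ↥K, ∑ i, (b i : ℤ) * (c : Fin l → ℤ) i = 0 := fun c => c.2
  -- `algebraMap A A[1/∏ mᵢ]` is injective: each `mᵢ` is a non-zero-divisor (`T = ∅`)
  have hreg : ∀ i, m i ∈ nonZeroDivisors A := fun i => by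
    refine mem_nonZeroDivisors_iff_right.mpr fun y hy => ?_
    have h := hperm i ∅ (Set.notMem_empty i) y (by rw [mul_comm, hy]; exact Ideal.zero_mem _)
    simpa using h
  have hinj : Function.Injective (algebraMap A (Localization.Away (∏ i, m i))) :=
    IsLocalization.injective (M := Submonoid.powers (∏ i, m i)) _
      (Submonoid.powers_le.mpr (prod_mem fun i _ => hreg i))
  -- the `mᵢ = v^{eᵢ}` lie in `J`
  have hmJ : ∀ i, algebraMap A S (m i) ∈ J := fun i => by
    rw [hJ]
    refine Ideal.subset_span ⟨Pi.single i 1, ?_, ?_⟩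
    · simp [Pi.single_apply, hb i]
    · rw [Subalgebra.coe_algebraMap, tropicalLinks_rayAlgebra_prod_zpow_single, hv]
  -- the coefficient map `A ⧸ (m) → S ⧸ J`
  let f : (A ⧸ Ideal.span (Set.range m)) →ₐ[A] (↥S ⧸ J) :=
    Ideal.Quotient.liftₐ _ (Algebra.ofId A _) (by
      intro a ha
      have hle : Ideal.span (Set.range m) ≤
          RingHom.ker ((Algebra.ofId A (↥S ⧸ J) : A →ₐ[A] ↥S ⧸ J) : A →+* ↥S ⧸ J) := by
        rw [Ideal.span_le]
        rintro _ ⟨i, rfl⟩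
        rw [SetLike.mem_coe, RingHom.mem_ker]
        exact Ideal.Quotient.eq_zero_iff_mem.mpr (hmJ i)
      exact hle ha)
  have hf : ∀ r, f (Ideal.Quotient.mk _ r) = Ideal.Quotient.mk J (algebraMap A S r) := fun r => rfl
  clear_value f
  -- the monomial map `K → S`, `a ↦ v^a`
  let gS : Multiplicative ↥K →* ↥S :=
    { toFun := fun a => ⟨((∏ i, v i ^ ((Multiplicative.toAdd a : ↥K) : Fin l → ℤ) i :
          (Localization.Away (∏ i, m i))ˣ) : Localization.Away (∏ i, m i)), by
        rw [hS]
        exact Algebra.subset_adjoin ⟨_, (hKmem _).ge, rfl⟩⟩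
      map_one' := Subtype.ext (by simp)
      map_mul' := fun a c => Subtype.ext (by simp [zpow_add, Finset.prod_mul_distrib]) }
  have hgS : ∀ a : ↥K, (gS (Multiplicative.ofAdd a) : Localization.Away (∏ i, m i)) =
      ((∏ i, v i ^ (a : Fin l → ℤ) i : (Localization.Away (∏ i, m i))ˣ) :
        Localization.Away (∏ i, m i)) := fun a => rfl
  clear_value gS
  -- the comparison map `Φ : (A ⧸ (m))[K] →ₐ[A] S ⧸ J`
  let Φ : AddMonoidAlgebra (A ⧸ Ideal.span (Set.range m)) ↥K →ₐ[A] (↥S ⧸ J) :=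
    AddMonoidAlgebra.liftNCAlgHom f
      ((Ideal.Quotient.mk J : ↥S →+* ↥S ⧸ J).toMonoidHom.comp gS) fun _ _ =>
        @Commute.all (↥S ⧸ J) _ _ _
  have hΦ : ∀ (a : ↥K) (r : A), Φ (AddMonoidAlgebra.single a (Ideal.Quotient.mk _ r)) =
      Ideal.Quotient.mk J (r • gS (Multiplicative.ofAdd a)) := by
    intro a r
    simp only [Φ, AddMonoidAlgebra.coe_liftNCAlgHom, AddMonoidAlgebra.liftNC_single,
      AddMonoidHom.coe_coe, MonoidHom.coe_comp, Function.comp_apply, RingHom.toMonoidHom_eq_coe,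
      MonoidHom.coe_coe]
    rw [hf, ← map_mul, Algebra.smul_def]
  clear_value Φ
  -- `Φ` is surjective: `S` is spanned by monomials, of weight `0` (hit) or `> 0` (killed)
  have hsurj : Function.Surjective Φ := by
    intro q
    obtain ⟨⟨x, hx⟩, rfl⟩ := Ideal.Quotient.mk_surjective q
    have hx' := hx
    rw [hS] at hx'
    suffices h : ∀ hx : x ∈ S, Ideal.Quotient.mk J ⟨x, hx⟩ ∈ Φ.range from h hx
    clear hx
    induction hx' using Algebra.adjoin_induction with
    | mem x hxT =>
      intro hx
      obtain ⟨a, ha, rfl⟩ := hxT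
      rcases ha.lt_or_eq with hpos | hzero
      · refine Φ.mem_range.mpr ⟨0, ?_⟩
        rw [map_zero, eq_comm, Ideal.Quotient.eq_zero_iff_mem, hJ]
        exact Ideal.subset_span ⟨a, hpos, rfl⟩
      · refine Φ.mem_range.mpr
          ⟨AddMonoidAlgebra.single ⟨a, hzero.symm⟩ (Ideal.Quotient.mk _ 1), ?_⟩
        rw [hΦ, one_smul]
        exact congrArg _ (Subtype.ext (hgS ⟨a, hzero.symm⟩))
    | algebraMap r =>
      intro hx
      refine Φ.mem_range.mpr ⟨algebraMap A _ r, ?_⟩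
      rw [AlgHom.commutes, ← Ideal.Quotient.mk_algebraMap]
      rfl
    | add x y hx' hy' ihx ihy =>
      intro h
      have hxS : x ∈ S := by rw [hS]; exact hx'
      have hyS : y ∈ S := by rw [hS]; exact hy'
      have e : (⟨x + y, h⟩ : ↥S) = ⟨x, hxS⟩ + ⟨y, hyS⟩ := rfl
      rw [e, map_add]
      exact add_mem (ihx hxS) (ihy hyS)
    | mul x y hx' hy' ihx ihy =>
      intro h
      have hxS : x ∈ S := by rw [hS]; exact hx'
      have hyS : y ∈ S := by rw [hS]; exact hy'
      have e : (⟨x * y, h⟩ : ↥S) = ⟨x, hxS⟩ * ⟨y, hyS⟩ := rfl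
      rw [e, map_mul]
      exact mul_mem (ihx hxS) (ihy hyS)
  -- `Φ` is injective: weighted quasi-regularity
  have hinjΦ : Function.Injective Φ := by
    rw [injective_iff_map_eq_zero]
    intro x hx
    have hlift : ∀ q : A ⧸ Ideal.span (Set.range m), ∃ r, Ideal.Quotient.mk _ r = q :=
      Ideal.Quotient.mk_surjective
    choose ρ hρ using hlift
    have hxsum : x = ∑ a ∈ x.coeff.support,
        AddMonoidAlgebra.single a (Ideal.Quotient.mk _ (ρ (x.coeff a))) := by
      conv_lhs => rw [← AddMonoidAlgebra.sum_coeff_single x]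
      simp only [hρ, Finsupp.sum]
    have hy : ∑ a ∈ x.coeff.support, ρ (x.coeff a) • gS (Multiplicative.ofAdd a) ∈ J := by
      rw [← Ideal.Quotient.eq_zero_iff_mem, map_sum, ← hx]
      conv_rhs => rw [hxsum, map_sum]
      exact Finset.sum_congr rfl fun a _ => (hΦ a _).symm
    have hyL := tropicalLinks_rayAlgebra_coe_mem_span_of_mem_span b v S hS _
      (by rw [← hJ]; exact hy)
    simp only [AddSubmonoidClass.coe_finsetSum, Subalgebra.coe_smul, hgS] at hyL
    have key := tropicalLinks_rayAlgebra_mem_span_of_sum_smul_mem m b hb hperm hinj v hv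
      x.coeff.support (fun a : ↥K => (a : Fin l → ℤ)) Subtype.val_injective.injOn
      (fun a _ => hKmem a) (fun a => ρ (x.coeff a)) hyL
    rw [hxsum]
    refine Finset.sum_eq_zero fun a ha => ?_
    rw [AddMonoidAlgebra.single_eq_zero]
    exact Ideal.Quotient.eq_zero_iff_mem.mpr (key a ha)
  exact ⟨(AlgEquiv.ofBijective Φ ⟨hinjΦ, hsurj⟩).symm⟩

end Summit.ResolutionOfSingularities.ResolutionOfSingularities.Theorems
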